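import Literature.Analysis.Complex.LittlePicard
import Mathlib.Analysis.Convex.Contractible
import Mathlib.Topology.Algebra.Module.LocallyConvex
import HarnessLib

/-!
# Stub `stub_lambdaLiftBall` of the line `registered` (skeleton v5.1) for the crux
# `UniformAnalyticExtension` (stmt-CriticalPhenomena-6047, route `CardyUSTContinuation`)

λ-engine 1 of the Schottky reduction: **holomorphic lifting through the universal covering
`λ : ℍ → ℂ ∖ {0, 1}` on a disc.**  A function `f` holomorphic on `ball c R` omitting the values
`0` and `1` factors as `f = λ ∘ F` on the ball, with `F` holomorphic there, valued in the upper
half-plane, and with any prescribed lift `F c = τ₀` of the centre (`λ τ₀ = f c`).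

Proof (exactly as `Literature.Analysis.Complex.exists_differentiable_lift_modularLambda`, which is
the case of an entire `f`): the open ball is convex, hence contractible and simply connected, and
locally path connected (an open subset of the locally convex space `ℂ`); the restriction of `f` to
the subtype `↥(ball c R)` is a continuous map into `ℂ ∖ {0,1}` and lifts through the covering map
`λ` (`Literature.NumberTheory.Automorphic.ModularLambda.exists_unique_lift_modularLambda`) to a
continuous `F₀ : ball c R → ℍ` with `F₀ c = τ₀`.  Extend `F₀` by the junk value `τ₀` off the ball;
on the ball the extension is continuous and solves `λ ∘ F = f` with `λ` analytic and `λ′ ≠ 0` on `ℍ`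
(`Literature.Analysis.Complex.deriv_modularLambda_ne_zero`), so it is analytic there
(`Literature.Analysis.Complex.analyticAt_of_comp_eq_of_deriv_ne_zero`).
-/

noncomputable section

open Filter Topology Set Metric

open scoped UpperHalfPlane

open Literature.NumberTheory.Automorphic (modularLambda)

namespace Summit.CriticalPhenomena.CardyFormulaZ2.Cruxes.UniformAnalyticExtension.Birth

open Literature.NumberTheory.Automorphic.ModularLambda Literature.Analysis.Complex

/-- **Continuous lifting through `λ` on a disc.** A function continuous on `ball c R` (`0 < R`)
omitting `0` and `1` is `λ ∘ F` on the ball for some `F : ℂ → ℂ` continuous on the ball, valued in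
the upper half-plane there, with prescribed `F c = τ₀ ∈ λ⁻¹(f c)`. [folklore] -/
theorem liftBall_exists_continuousOn_lift {f : ℂ → ℂ} {c : ℂ} {R : ℝ} (hR : 0 < R)
    (hf : ContinuousOn f (ball c R)) (h0 : ∀ z ∈ ball c R, f z ≠ 0)
    (h1 : ∀ z ∈ ball c R, f z ≠ 1) {τ₀ : ℂ} (hτ₀ : 0 < τ₀.im) (hl : modularLambda τ₀ = f c) :
    ∃ F : ℂ → ℂ, ContinuousOn F (ball c R) ∧ (∀ z ∈ ball c R, 0 < (F z).im) ∧ F c = τ₀ ∧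
      ∀ z ∈ ball c R, modularLambda (F z) = f z := by
  classical
  haveI : ContractibleSpace (ball c R) :=
    (convex_ball c R).contractibleSpace ⟨c, mem_ball_self hR⟩
  haveI : LocallyPathConnectedSpace (ball c R) := isOpen_ball.locallyPathConnectedSpace
  -- lift the restriction of `f` to the (simply connected, locally path connected) open ball
  have hgc : Continuous ((ball c R).restrict f) := continuousOn_iff_continuous_restrict.mp hf
  obtain ⟨F₀, ⟨hF₀c, hF₀⟩, -⟩ :=
    exists_unique_lift_modularLambda (f := (ball c R).restrict f) hgc (fun a ↦ h0 a a.2)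
      (fun a ↦ h1 a a.2) ⟨c, mem_ball_self hR⟩ ⟨τ₀, hτ₀⟩ hl
  -- extend the lift by the junk value `τ₀` off the ball
  have hFin : ∀ z (h : z ∈ ball c R),
      (fun w ↦ if hw : w ∈ ball c R then ((F₀ ⟨w, hw⟩ : ℍ) : ℂ) else τ₀) z = (F₀ ⟨z, h⟩ : ℂ) :=
    fun z h ↦ dif_pos h
  refine ⟨fun w ↦ if hw : w ∈ ball c R then ((F₀ ⟨w, hw⟩ : ℍ) : ℂ) else τ₀, ?_,
    fun z hz ↦ ?_, ?_, fun z hz ↦ ?_⟩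
  · rw [continuousOn_iff_continuous_restrict]
    have heq : (ball c R).restrict
        (fun w ↦ if hw : w ∈ ball c R then ((F₀ ⟨w, hw⟩ : ℍ) : ℂ) else τ₀) =
        fun a ↦ ((F₀ a : ℍ) : ℂ) := by
      funext a
      exact hFin a a.2
    rw [heq]
    exact UpperHalfPlane.continuous_coe.comp F₀.continuous
  · rw [hFin z hz]
    exact (F₀ ⟨z, hz⟩).coe_im_pos
  · rw [hFin c (mem_ball_self hR), hF₀c]
  · rw [hFin z hz]
    exact hF₀ ⟨z, hz⟩

/-- **stub_lambdaLiftBall** (λ-engine 1 of the Schottky reduction of the crux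
`UniformAnalyticExtension`): a function holomorphic on `ball c R` omitting `0` and `1` lifts
through the modular function `λ` to a function holomorphic on the ball, with values in the upper
half-plane and any prescribed lift `F c = τ₀ ∈ λ⁻¹(f c)` of the centre, `λ ∘ F = f` on the ball.
(Continuous lift through the covering `λ : ℍ → ℂ ∖ {0,1}`, analytic because `λ′ ≠ 0`.)
[folklore] -/
theorem stub_lambdaLiftBall :
    ∀ (f : ℂ → ℂ) (c : ℂ) (R : ℝ), 0 < R → DifferentiableOn ℂ f (ball c R) →
      (∀ z ∈ ball c R, f z ≠ 0) → (∀ z ∈ ball c R, f z ≠ 1) →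
      ∀ τ₀ : ℂ, 0 < τ₀.im → modularLambda τ₀ = f c →
      ∃ F : ℂ → ℂ, DifferentiableOn ℂ F (ball c R) ∧ (∀ z ∈ ball c R, 0 < (F z).im) ∧ F c = τ₀ ∧
        ∀ z ∈ ball c R, modularLambda (F z) = f z := by
  intro f c R hR hf h0 h1 τ₀ hτ₀ hl
  obtain ⟨F, hFc, hFim, hF0, hFl⟩ :=
    liftBall_exists_continuousOn_lift hR hf.continuousOn h0 h1 hτ₀ hl
  refine ⟨F, fun a ha ↦ ?_, hFim, hF0, hFl⟩
  have han : AnalyticAt ℂ modularLambda (F a) :=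
    differentiableOn_modularLambda.analyticAt
      ((isOpen_lt continuous_const Complex.continuous_im).mem_nhds (hFim a ha))
  have hpF : ∀ᶠ z in 𝓝 a, modularLambda (F z) = f z := by
    filter_upwards [isOpen_ball.mem_nhds ha] with z hz
    exact hFl z hz
  exact (analyticAt_of_comp_eq_of_deriv_ne_zero han (deriv_modularLambda_ne_zero (hFim a ha))
    (hFc.continuousAt (isOpen_ball.mem_nhds ha)) (hf.analyticAt (isOpen_ball.mem_nhds ha))
    hpF).differentiableAt.differentiableWithinAt

end Summit.CriticalPhenomena.CardyFormulaZ2.Cruxes.UniformAnalyticExtension.Birth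

end
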